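import Mathlib
import HarnessLib
import Summits.AtomisticToContinuum.FouriersLaw.Theses.OddSectorIrreversibility
import Literature.MathematicalPhysics.KineticTheory.LangevinChainKernel
import Literature.MathematicalPhysics.KineticTheory.LangevinChainGibbs

/-!
# Sketch — crux ideas for `ConeScaleCorrector` (E1), ideator 1, round 1

First lemmas (signatures only; `def … : Prop`, nothing proved here) for the two crux idea cards

* `gamblers-ruin-defect`      — `GeneratorOfLeftWeightedEnergy`, `CorrectorSplitting`,
                                 `ContactDefectBound`, glue shape `GamblersRuinGlue`;
* `one-crossing-echo-contraction` — `FiniteHorizonBudget`, `OneCrossingContraction`,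
                                 glue shape `EchoGlue`.

Conventions are those of the crux decl verbatim: `P := pinnedChain ω₂ lam β γ`,
`μT := volume.withDensity (exp(−H_N/T))` (unnormalised Gibbs weight, mass `Z`),
`J := Σ_i bondCurrent N i`, equilibrium OPEN kernels `P.transitionKernel N T T t`.
-/

namespace Summit.AtomisticToContinuum.FouriersLaw.Cruxes.ConeScaleCorrector.IdeatorOne

open MeasureTheory Filter Set
open scoped BigOperators ENNReal NNReal Topology

open Literature.MathematicalPhysics.KineticTheory.HeatConduction

noncomputable section

/-- Site energy `e_k = p_k²/2 + U(q_k) + ½V(q_{k+1} − q_k) + ½V(q_k − q_{k−1})` (bond energies split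
evenly, absent bonds contribute `0`) — the split used by the tree's `energyMoment`. -/
def siteEnergy (P : OscillatorChain) (N : ℕ) (k : Fin N) (x : PhaseSpace N) : ℝ :=
  x.2 k ^ 2 / 2 + P.U (x.1 k)
    + (1 / 2) * ∑ l : Fin N, (if l.val = k.val + 1 then P.V (x.1 l - x.1 k) else 0)
    + (1 / 2) * ∑ l : Fin N, (if k.val = l.val + 1 then P.V (x.1 k - x.1 l) else 0)

/-- Gambler's-ruin (harmonic-measure) weight: the LEFT-exit share `s(k) = 1 − k/(N−1)` of an energy
excess at site `k` under linear (local-equilibrium) splitting between the two baths. -/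
def leftShare (N : ℕ) (k : Fin N) : ℝ := 1 - (k.val : ℝ) / ((N : ℝ) - 1)

/-- Left-exit-weighted energy `E_L = Σ_k s(k) e_k` (uncentred). -/
def leftWeightedEnergy (P : OscillatorChain) (N : ℕ) (x : PhaseSpace N) : ℝ :=
  ∑ k : Fin N, leftShare N k * siteEnergy P N k x

/-- Power injected by the LEFT bath, `w_L = γ (T − p_0²)` (the OU part of the generator applied to
`p_0²/2`; `L H = w_L + w_R`, tree: `generator_hamiltonian_two_baths`). Written as a sum over
`i = 0` to avoid a `0 < N` side condition. -/
def bathPowerLeft (P : OscillatorChain) (N : ℕ) (T : ℝ) (x : PhaseSpace N) : ℝ :=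
  ∑ i : Fin N, (if i.val = 0 then P.γ * (T - x.2 i ^ 2) else 0)

/-- Unnormalised Gibbs weight `e^{−H_N/T} dq dp` of the crux (verbatim shape). -/
def gibbsW (P : OscillatorChain) (N : ℕ) (T : ℝ) : Measure (PhaseSpace N) :=
  volume.withDensity (fun x : PhaseSpace N => ENNReal.ofReal (Real.exp (-(P.hamiltonian N x) / T)))

/-- Its mass `Z`. -/
def gibbsZ (P : OscillatorChain) (N : ℕ) (T : ℝ) : ℝ :=
  ∫ x, Real.exp (-(P.hamiltonian N x) / T) ∂(volume : Measure (PhaseSpace N))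

/-- Total current `J = Σ_i j_i`. -/
def Jtot (P : OscillatorChain) (N : ℕ) (z : PhaseSpace N) : ℝ := ∑ i : Fin N, P.bondCurrent N i z

/-- Finite-horizon Kubo forecast of an observable `f` under the equilibrium OPEN kernels:
`u^f_S(x) = ∫₀^S (P_t f)(x) dt`. -/
def forecast (P : OscillatorChain) (N : ℕ) (T : ℝ) (f : PhaseSpace N → ℝ) (S : ℝ)
    (x : PhaseSpace N) : ℝ :=
  ∫ t in Set.Ioc (0 : ℝ) S, (∫ y, f y ∂(P.transitionKernel N T T t.toNNReal x))

/-- `u` is an a.e. limit of the finite-horizon forecasts of `f` (the crux's corrector predicate, for a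
general observable). -/
def IsCorrectorOf (P : OscillatorChain) (N : ℕ) (T : ℝ) (f u : PhaseSpace N → ℝ) : Prop :=
  ∀ᵐ x ∂(gibbsW P N T), Tendsto (fun τ : ℝ => forecast P N T f τ x) atTop (𝓝 (u x))

/-! ## Card `gamblers-ruin-defect` -/

/-- **First lemma (fixed N, provable now; size S–M).** The generator maps the left-exit-weighted energy
to the left bath power minus the LENGTH-AVERAGED current:
`L E_L = w_L − J_tot/(N−1)` for `N ≥ 2` — local energy balance `L e_k = j_{k−1} − j_k (+ w_L at k = 0,
+ w_R at k = N−1)` summed against the harmonic weight `s(k) = 1 − k/(N−1)` (`s(0) = 1`, `s(N−1) = 0`,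
constant increments `−1/(N−1)`). Companion of the tree's `pinnedChain_generator_energyMoment`
(`L X = J` at `γ = 0`). -/
def GeneratorOfLeftWeightedEnergy : Prop :=
  ∀ ω₂ lam β γ T : ℝ, ∀ N : ℕ, 2 ≤ N → ∀ x : PhaseSpace N,
    (pinnedChain ω₂ lam β γ).generator N T T (leftWeightedEnergy (pinnedChain ω₂ lam β γ) N) x =
      bathPowerLeft (pinnedChain ω₂ lam β γ) N T x
        - (1 / ((N : ℝ) - 1)) * Jtot (pinnedChain ω₂ lam β γ) N x

/-- **Corrector splitting (fixed N; Dynkin + ergodicity of the equilibrium open chain, CEHR 2018).**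
Every corrector `u` of `J_tot` equals `(N−1)·v` a.e., where the DEFECT `v = W + (E_L − ⟨E_L⟩)` is built
from ANY corrector `W` of the one-site observable `w_L`: `u = (N−1)(W + E_L − c)` μ_T-a.e., with
`c = ⟨E_L⟩_π`. (All single-bond correctors `u_i` share this defect: `u_i = v + u_i^{LE}`,
`u_i^{LE} = Σ_k [k/(N−1) − 1(k>i)] ẽ_k`, `Σ_i u_i^{LE} = 0`.) -/
def CorrectorSplitting : Prop :=
  ∀ ω₂ lam β γ : ℝ, 0 < ω₂ → 0 < lam → 0 < β → 0 < γ → ∀ T : ℝ, 0 < T → ∀ N : ℕ, 2 ≤ N →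
    ∀ u W : PhaseSpace N → ℝ,
      let P := pinnedChain ω₂ lam β γ
      IsCorrectorOf P N T (Jtot P N) u → IsCorrectorOf P N T (bathPowerLeft P N T) W →
        ∀ᵐ x ∂(gibbsW P N T),
          u x = ((N : ℝ) - 1) * (W x + leftWeightedEnergy P N x
            - (∫ y, leftWeightedEnergy P N y ∂(gibbsW P N T)) / gibbsZ P N T)

/-- Existence of an `L²` corrector of the left bath power (fixed N; the `w_L`-instance of the route's
`CorrectorTheory` conjunct A). -/
def BathPowerCorrectorExists : Prop :=
  ∀ ω₂ lam β γ : ℝ, 0 < ω₂ → 0 < lam → 0 < β → 0 < γ → ∀ T : ℝ, 0 < T → ∀ N : ℕ, 2 ≤ N →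
    let P := pinnedChain ω₂ lam β γ
    ∃ W : PhaseSpace N → ℝ, MemLp W 2 (gibbsW P N T) ∧ IsCorrectorOf P N T (bathPowerLeft P N T) W

/-- **V1 = E1 in defect form (the transferred crux; N-uniform, the hard content).** The defect
`v = W + Ẽ_L` — "expected lifetime heat drawn from the left bath + left-exit share of the present
energy excess" — is `O(1)` in `L²(μ_T)` uniformly in `N`: `∫ v² dμ_T ≤ C·Z`. Equivalent to E1 by
`CorrectorSplitting` (`u = (N−1)v`), but CANCELLATION-FREE and sourced at ONE contact. -/
def ContactDefectBound : Prop :=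
  ∀ ω₂ lam β γ : ℝ, 0 < ω₂ → 0 < lam → 0 < β → 0 < γ → ∀ T : ℝ, 0 < T → ∃ C : ℝ, ∀ N : ℕ, 2 ≤ N →
    ∀ W : PhaseSpace N → ℝ,
      let P := pinnedChain ω₂ lam β γ
      IsCorrectorOf P N T (bathPowerLeft P N T) W → MemLp W 2 (gibbsW P N T) →
        let v : PhaseSpace N → ℝ := fun x => W x + leftWeightedEnergy P N x
            - (∫ y, leftWeightedEnergy P N y ∂(gibbsW P N T)) / gibbsZ P N T
        MemLp v 2 (gibbsW P N T) ∧ ∫ x, (v x) ^ 2 ∂(gibbsW P N T) ≤ C * gibbsZ P N T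

/-- The degenerate slice `N ≤ 1` of E1 (PROVED by refuter rattack-14069, Evidence.lean
`coneScaleCorrector_slice_le_one`: `J_tot ≡ 0 ⇒ u = 0` a.e.); restated so the glue can case on `N`. -/
def SliceLeOne : Prop :=
  ∀ ω₂ lam β γ : ℝ, 0 < ω₂ → 0 < lam → 0 < β → 0 < γ → ∀ T : ℝ, 0 < T → ∀ N : ℕ, N ≤ 1 →
    ∀ u : PhaseSpace N → ℝ,
      let P := pinnedChain ω₂ lam β γ
      IsCorrectorOf P N T (Jtot P N) u →
        MemLp u 2 (gibbsW P N T) ∧ ∫ x, (u x) ^ 2 ∂(gibbsW P N T) ≤ 0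

/-- Glue shape of card 1 (bookkeeping: `∫u² = (N−1)²∫v² ≤ (N−1)²·C·Z ≤ C·N²·Z`). -/
def GamblersRuinGlue : Prop :=
  BathPowerCorrectorExists → CorrectorSplitting → ContactDefectBound → SliceLeOne →
    Summit.AtomisticToContinuum.FouriersLaw.Theses.OddSectorIrreversibility.ConeScaleCorrector

/-! ## Card `one-crossing-echo-contraction` -/

/-- **(B) Finite-horizon budget up to one crossing** (= the promote seat's `ConeTransportBudget` C1 at
horizon `aN`; conditional-Jensen shadow of the OPEN chain's Einstein–Helfand bound, E2's open twin):
`∫ (u_S)² dμ_T ≤ C·N²·Z` for all `S ∈ [0, a·N]`, with `u_S = ∫₀^S P_tJ_tot dt` EXPLICIT (no limit). -/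
def FiniteHorizonBudget (a : ℝ) : Prop :=
  ∀ ω₂ lam β γ : ℝ, 0 < ω₂ → 0 < lam → 0 < β → 0 < γ → ∀ T : ℝ, 0 < T → ∃ C : ℝ, ∀ N : ℕ, ∀ S : ℝ,
    0 ≤ S → S ≤ a * N →
      let P := pinnedChain ω₂ lam β γ
      ∫ x, (forecast P N T (Jtot P N) S x) ^ 2 ∂(gibbsW P N T) ≤ C * (N : ℝ) ^ 2 * gibbsZ P N T

/-- **(EC′) One-crossing echo contraction, affine form** — the irreducible scrambling content of E1:
there are `θ < 1`, `b` such that for EVERY horizon `S` the one-crossing propagation of the forecast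
contracts up to an `O(N)` remainder,
`‖P_{aN} u_S‖_{L²(μ_T)} ≤ θ‖u_S‖ + b·N·√Z`, where `P_{aN}u_S = u_{S+aN} − u_{aN}` (Chapman–Kolmogorov)
and `‖P_{aN}u_S‖² = ⟨ΘP_{aN}ΘP_{aN}u_S, u_S⟩` is a LOSCHMIDT-ECHO fidelity (forward `aN`, flip,
forward `aN` with fresh boundary noise, flip). The sharp conjecture is `b = 0` (pure contraction,
`θ_N² = R(aN)/R(0)` bounded away from `1`). Both (B) and (EC′) fail at `lam = β = 0`. -/
def OneCrossingContraction (a : ℝ) : Prop :=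
  ∀ ω₂ lam β γ : ℝ, 0 < ω₂ → 0 < lam → 0 < β → 0 < γ → ∀ T : ℝ, 0 < T →
    ∃ θ b : ℝ, θ < 1 ∧ ∀ N : ℕ, ∀ S : ℝ, 0 ≤ S →
      let P := pinnedChain ω₂ lam β γ
      Real.sqrt (∫ x, (forecast P N T (Jtot P N) (S + a * N) x - forecast P N T (Jtot P N) (a * N) x) ^ 2
          ∂(gibbsW P N T))
        ≤ θ * Real.sqrt (∫ x, (forecast P N T (Jtot P N) S x) ^ 2 ∂(gibbsW P N T))
          + b * (N : ℝ) * Real.sqrt (gibbsZ P N T)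

/-- Measurability/`L²` bookkeeping for the explicit forecasts (fixed N; from the CONSTRUCTED kernels). -/
def ForecastMemLp : Prop :=
  ∀ ω₂ lam β γ : ℝ, 0 < ω₂ → 0 < lam → 0 < β → 0 < γ → ∀ T : ℝ, 0 < T → ∀ N : ℕ, ∀ S : ℝ, 0 ≤ S →
    let P := pinnedChain ω₂ lam β γ
    MemLp (forecast P N T (Jtot P N) S) 2 (gibbsW P N T)

/-- Glue shape of card 2: induction over crossings (`u_{S+aN} = u_{aN} + P_{aN}u_S`, so
`m_{k+1} ≤ A + θ m_k + bN√Z` ⇒ `sup_S ‖u_S‖ ≤ (A + bN√Z)/(1−θ) ≲ N√Z`) and FATOU along the crux's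
a.e.-limit hypothesis (`∫u² ≤ liminf_S ∫u_S²`) — concludes the route decl BY NAME. -/
def EchoGlue : Prop :=
  ∀ a : ℝ, 0 < a → FiniteHorizonBudget a → OneCrossingContraction a → ForecastMemLp →
    Summit.AtomisticToContinuum.FouriersLaw.Theses.OddSectorIrreversibility.ConeScaleCorrector

end

end Summit.AtomisticToContinuum.FouriersLaw.Cruxes.ConeScaleCorrector.IdeatorOne
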